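import Summits.BirchSwinnertonDyer.BirchSwinnertonDyer.Theorems.QuadraticBranchSignedControlPlusEtaNonsurjPlusCoeffCongruence
import Summits.BirchSwinnertonDyer.BirchSwinnertonDyer.Theorems.QuadraticBranchSignedControlPlusEtaNonsurjMinusCoeffCongruenceHigher
import HarnessLib

/-!
# Route `QuadraticBranchSignedControl` (rung K8, cell `bsd-potss`), residual crux `PlusEtaMainConjectureNonsurj`
# (stmt-BirchSwinnertonDyer-19606): THE θ-COEFFICIENT CONGRUENCE FOR THE HIGHER COEFFICIENTS, PLUS SIDE — `coeff_k L_p⁺(V, η, X)`,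
# `k < p`, read off the EVEN-level Mazur–Tate element `θ_{2m}(η)`: the unitriangular system
# `coeff_kθ_{2m}(η) = (−1)^{m+1} Σ_{s+t=k} (ω⁻_{2m})_s · coeff_t M⁺ + p^{2m}·r_k`, `(ω⁻_{2m})_0 = p^m`, `p^m ∣ (ω⁻_{2m})_s` (`0 < s < p − 1`)
# (seat `bsd-potss-k8eta-c2` g25; plus twin of g24's `…MinusCoeffCongruenceHigher.lean`)

WHY. v7's stub `stub_analyticEtaMu_cm` asks `HasUnitContent Lη` (analytic `μ⁺ = 0`) for every plus branch function of every CM row, and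
every census law of the crux speaks of PARI's `λ⁺` (g18: `λ⁺_η(V) = 0 ⟺ p ∤ #Ш_an(W)` on 12382 rows; g19 P11; the 455 rank-zero CM rows at
`p = 5` with `λ⁺ = 2`). So far `μ⁺`/`λ⁺` are MEASURED (`ellpadiclambdamu`). The prequel `…PlusCoeffCongruence` reads `coeff₀` and `coeff₁`
only. THIS FILE proves the plus twin of g24's triangular congruence for ALL `k < p`: with `M⁺` the even-level Mazur–Tate limit of
bsd-potss-ctrl (`exists_isCongrModOmega_quadraticBranch_even`: `θ_{2m}(η) ≡ (−1)^{m+1} ω⁻_{2m} M⁺ (mod ω_{2m})`, made integral by g24's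
`exists_sub_eq_omega_mul_of_isCongrModOmega`), comparing the coefficients of `X^k` in `Θ − (−1)^{m+1}ω⁻_{2m}M⁺ = ω_{2m}q` gives
(i) `coeff_kθ_{2m}(η) = (−1)^{m+1} Σ_{(s,t), s+t=k} (ω⁻_{2m})_s·coeff_tM⁺ + p^{2m}·r_k` (`(ω_{2m})_0 = 0`, `p^{2m} ∣ (ω_{2m})_s = C(p^{2m},s)` for
`0 < s < p`); (ii) the diagonal `(ω⁻_{2m})_0 = p^m` (prequel) and `p^m ∣ (ω⁻_{2m})_s` for `0 < s < p − 1` — `ω⁻_{2m} = Φ_p(1+X)·∏_{i<m−1}Φ_{p^{2i+3}}(1+X)`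
has `m` factors each Eisenstein at `p`, the first of degree `p − 1` (so the bound `s < p − 1` is SHARP: `(ω⁻_{2m})_{p−1} = p^{m−1}·(1 + p·…)`);
hence the system is unitriangular with diagonal `p^m` in the range `k < p − 1`, and in the range `k < p` on the rows with `M⁺(0) = 0`
(analytic rank `≥ 1`). The λ⁺-reading (`μ(L⁺) = 0 ∧ λ(L⁺) = λ` from `λ + 1` exact rationals, `λ < p − 1`) is the sequel `…PlusCoeffCongruenceLambda`.

WHAT. §8 `dvd_coeff_cyclotomic_prime_comp_X_add_one_of_lt` (`p ∣ Φ_p(1+X)_j`, `j < p−1`), `pow_dvd_coeff_cyclotomicOmegaMinus_two_mul`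
(`p^m ∣ (ω⁻_{2m})_j`, `j < p − 1`); §9 `exists_coeff_mazurTate_plus_eq_sum` (the triangular identity for `M⁺`, `k < p`).

HONEST FRAMING (cell `bsd-potss`; FULL-BSD rank ≤ 1 programme, HUMAN RULING D-0036/D-0074): TOOL THEOREMS ONLY — no definition, no named fact,
no `sorry`, axioms standard; nothing about (A), (C1⁺_η), C-cc-1 or `BSD(W,p)` of any pair is claimed; no stub of 19606 is proved; crux and route
OPEN; nothing booked. `--supports stmt-BirchSwinnertonDyer-19606`.

References: [Pollack2003] Prop. 6.18, §6.5; [Kobayashi2003] Thm. 3.2, (3.4), (3.6) (p. 7); [MazurTateTeitelbaum1986Invent] §I.13; [Washington1997] §7.1.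
-/

set_option autoImplicit false
set_option linter.dupNamespace false
noncomputable section

open scoped Classical MatrixGroups ModularForm

open CongruenceSubgroup Polynomial Literature.NumberTheory.EllipticCurves
  Literature.NumberTheory.EllipticCurves.ModularForms
open Summit.BirchSwinnertonDyer.Rank1Residual.Additive
open Summit.BirchSwinnertonDyer.BirchSwinnertonDyer.Theorems.EtaMinusCoeffCongruence

namespace Summit.BirchSwinnertonDyer.BirchSwinnertonDyer.Theorems.EtaPlusCoeffCongruence

variable {p : ℕ} [hp : Fact p.Prime]

/-! ## §8 Low coefficients of `ω⁻_{2m}` -/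

/-- The coefficients of `Φ_p(1+X)` below degree `p − 1` lie in `(p)` (Eisenstein at `p`; the bound is sharp: the coefficient of `X^{p−1}` is `1`).
[cite: Washington1997, §7.1] -/
theorem dvd_coeff_cyclotomic_prime_comp_X_add_one_of_lt :
    ∀ j < p - 1, (p : ℤ) ∣ ((cyclotomic p ℤ).comp (X + 1)).coeff j := by
  intro j hj
  have hP := hp.out
  have hE := cyclotomic_comp_X_add_one_isEisensteinAt p
  have hdeg : ((cyclotomic p ℤ).comp (X + 1)).natDegree = p - 1 := by
    rw [natDegree_comp, natDegree_cyclotomic, Nat.totient_prime hP,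
      show (X + 1 : ℤ[X]) = X + C 1 by rw [C_1], natDegree_X_add_C, mul_one]
  have hlt : j < ((cyclotomic p ℤ).comp (X + 1)).natDegree := by rw [hdeg]; exact hj
  exact Ideal.mem_span_singleton.mp (hE.mem hlt)

/-- **`p^m ∣ (ω⁻_{2m})_j` for every `j < p − 1`** (`ω⁻_{2m} = ω⁻_{2m−1} = Φ_p(1+X)·∏_{i<m−1} Φ_{p^{2i+3}}(1+X)`, `m` factors with coefficients
below degree `p − 1` in `(p)`; `(ω⁻_{2m})_0 = p^m` exactly, `coeff_zero_cyclotomicOmegaMinus_two_mul`). [cite: Pollack2003, §6.5 (display before Prop. 6.18)] -/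
theorem pow_dvd_coeff_cyclotomicOmegaMinus_two_mul (m : ℕ) :
    ∀ j < p - 1, (p : ℤ) ^ m ∣ (cyclotomicOmegaMinus p (2 * m)).coeff j := by
  rcases m with _ | m
  · intro j _
    rw [pow_zero]
    exact one_dvd _
  · have hP := hp.out
    rw [show 2 * (m + 1) = 2 * m + 2 by ring, ← cyclotomicOmegaMinus_two_mul_add_one,
      cyclotomicOmegaMinus_two_mul_add_one_eq_prod, mul_comm]
    have hprod := pow_dvd_coeff_prod_range (p := p) (D := p - 1)
      (fun i ↦ (cyclotomic (p ^ (2 * i + 3)) ℤ).comp (X + 1))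
      (fun i j hj ↦ dvd_coeff_cyclotomic_comp_X_add_one_of_lt (p := p) (2 * i + 1) j
        (lt_of_lt_of_le hj (Nat.le_mul_of_pos_left (p - 1) hP.pos))) m
    exact pow_succ_dvd_coeff_mul hprod dvd_coeff_cyclotomic_prime_comp_X_add_one_of_lt

/-! ## §9 The triangular identity for `coeff_k M⁺`, `k < p` -/

section MazurTate

variable {N : ℕ} [NeZero N] {f : CuspForm (Gamma0 N) 2}

/-- **THE TRIANGULAR IDENTITY for `coeff_k M⁺`, `k < p` (plus side).** If `M ∈ Λ` satisfies `θ_{2m}(η) ≡ (−1)^{m+1}ω⁻_{2m}M (mod ω_{2m})` then for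
every `k < p` there is `r ∈ ℤ_p` with
`coeff_kθ_{2m}(η) = (−1)^{m+1} Σ_{(s,t) : s+t=k} (ω⁻_{2m})_s · coeff_tM + p^{2m}·r` in `ℚ_p` — the `ω_{2m}q` term contributes `p^{2m}r` because
`(ω_{2m})_0 = 0` and `p^{2m} ∣ (ω_{2m})_s = C(p^{2m},s)` for `0 < s ≤ k < p`. With `(ω⁻_{2m})_0 = p^m` and `p^m ∣ (ω⁻_{2m})_s` (`0 < s < p−1`, §8) this
is a unitriangular system for the `coeff_tM mod p^{m+1}`, `t ≤ k < p − 1`. [cite: Pollack2003, Prop. 6.18] [cite: MazurTateTeitelbaum1986Invent, §I.13] -/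
theorem exists_coeff_mazurTate_plus_eq_sum (hp2 : p ≠ 2) (hf0 : IsNewform0 f) (hQ : coeffField f = ⊥)
    (hpN : ¬ p ∣ N) (hap : cuspCoeff f p = ((0 : ℤ) : ℂ)) (m : ℕ) {k : ℕ} (hk : k < p) {M : IwasawaAlgebra p}
    (hM : IsCongrModOmega p (2 * m) (quadraticBranchMazurTateElement p f (2 * m))
      ((-1) ^ (m + 1) * cyclotomicOmegaMinus p (2 * m)) M) :
    ∃ r : ℤ_[p], (((quadraticBranchMazurTateElement p f (2 * m)).coeff k : ℚ) : ℚ_[p]) =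
      (-1) ^ (m + 1) * (∑ x ∈ Finset.HasAntidiagonal.antidiagonal k,
        (((cyclotomicOmegaMinus p (2 * m)).coeff x.1 : ℤ) : ℚ_[p]) * ((PowerSeries.coeff x.2 M : ℤ_[p]) : ℚ_[p])) +
        (p : ℚ_[p]) ^ (2 * m) * (r : ℚ_[p]) := by
  obtain ⟨Θ, q, hΘ, hid⟩ := exists_sub_eq_omega_mul_of_isCongrModOmega hp2 hf0 hQ hpN hap hM
  set ωp : ℤ_[p][X] := ((-1) ^ (m + 1) * cyclotomicOmegaMinus p (2 * m)).map (Int.castRingHom ℤ_[p]) with hωp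
  set Ω : ℤ_[p][X] := (cyclotomicOmega p (2 * m)).map (Int.castRingHom ℤ_[p]) with hΩ
  -- the `ω_n q` term is divisible by `p^n` in degree `k`
  have hΩdvd : ∀ s ≤ k, (p : ℤ_[p]) ^ (2 * m) ∣ Ω.coeff s := by
    intro s hs
    rcases Nat.eq_zero_or_pos s with rfl | hs0
    · rw [hΩ, Polynomial.coeff_map, coeff_zero_cyclotomicOmega, map_zero]
      exact dvd_zero _
    · rw [hΩ, Polynomial.coeff_map, coeff_cyclotomicOmega_of_pos _ hs0, map_natCast]
      have h := Nat.cast_dvd_cast (α := ℤ_[p]) (prime_pow_dvd_choose_prime_pow (p := p) (2 * m) hs0 (by omega))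
      push_cast at h
      exact h
  have hdvd : (p : ℤ_[p]) ^ (2 * m) ∣ PowerSeries.coeff k ((Ω : PowerSeries ℤ_[p]) * q) := by
    rw [PowerSeries.coeff_mul]
    refine Finset.dvd_sum fun x hx ↦ ?_
    have hx' : x.1 + x.2 = k := Finset.HasAntidiagonal.mem_antidiagonal.mp hx
    rw [Polynomial.coeff_coe]
    exact Dvd.dvd.mul_right (hΩdvd x.1 (by omega)) _
  obtain ⟨r, hr⟩ := hdvd
  refine ⟨r, ?_⟩
  -- the `ω⁻ M` term
  have hωcoeff : ∀ s, ωp.coeff s = (-1) ^ (m + 1) * (((cyclotomicOmegaMinus p (2 * m)).coeff s : ℤ) : ℤ_[p]) := by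
    intro s
    rw [hωp, Polynomial.coeff_map, show ((-1 : ℤ[X]) ^ (m + 1)) = C ((-1 : ℤ) ^ (m + 1)) by simp, coeff_C_mul]
    simp
  have h1 := congrArg (PowerSeries.coeff k) hid
  rw [map_sub, hr, PowerSeries.coeff_mul, Polynomial.coeff_coe] at h1
  simp only [Polynomial.coeff_coe, hωcoeff] at h1
  have hΘk : Θ.coeff k = (-1) ^ (m + 1) * (∑ x ∈ Finset.HasAntidiagonal.antidiagonal k,
      (((cyclotomicOmegaMinus p (2 * m)).coeff x.1 : ℤ) : ℤ_[p]) * PowerSeries.coeff x.2 M) +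
      (p : ℤ_[p]) ^ (2 * m) * r := by
    rw [Finset.mul_sum]
    have : ∑ x ∈ Finset.HasAntidiagonal.antidiagonal k, (-1) ^ (m + 1) *
        ((((cyclotomicOmegaMinus p (2 * m)).coeff x.1 : ℤ) : ℤ_[p]) * PowerSeries.coeff x.2 M) =
        ∑ x ∈ Finset.HasAntidiagonal.antidiagonal k, (-1) ^ (m + 1) * (((cyclotomicOmegaMinus p (2 * m)).coeff x.1 : ℤ) : ℤ_[p]) *
          PowerSeries.coeff x.2 M := Finset.sum_congr rfl fun x _ ↦ by ring
    rw [this]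
    linear_combination h1
  have hc := congrArg (fun P : ℚ_[p][X] ↦ P.coeff k) hΘ
  simp only [Polynomial.coeff_map, eq_ratCast] at hc
  rw [← hc, hΘk]
  simp only [map_add, map_mul, map_sum, map_pow, map_neg, map_one, map_natCast, map_intCast,
    PadicInt.algebraMap_apply]

end MazurTate

end Summit.BirchSwinnertonDyer.BirchSwinnertonDyer.Theorems.EtaPlusCoeffCongruence

end
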